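import Summits.BirchSwinnertonDyer.BirchSwinnertonDyer.Theorems.AlignedTransportAtTwoMainConjectureOfRankZeroBSDAtTwoSelmerLayerMuDoorComplete
import Summits.BirchSwinnertonDyer.BirchSwinnertonDyer.Theorems.AlignedTransportAtTwoMainConjectureOfRankZeroBSDAtTwoSelmerLayerMuDoorOneLayer
import Summits.BirchSwinnertonDyer.BirchSwinnertonDyer.Theorems.AlignedTransportAtTwoMainConjectureOfRankZeroBSDAtTwoSelmerLayerMuDoorTowerGap
import Summits.BirchSwinnertonDyer.BirchSwinnertonDyer.Theorems.AlignedTransportAtTwoMainConjectureOfRankZeroBSDAtTwoSelmerLayerMuDoorCrux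
import Literature.NumberTheory.EllipticCurves.SelmerDescentCurrencyProofs
import HarnessLib

/-!
# Route `AlignedTransportAtTwo`, crux C2 `MainConjectureOfRankZeroBSDAtTwo` (stmt-BirchSwinnertonDyer-22298):
# THE `μ`-DOOR IN DESCENT CURRENCY — stub T per curve ⟺ an inequality between the orders of two honest `2`-SELMER GROUPS
# `Sel^(2)(E/ℚ_n) ⊆ H¹(ℚ_n, E[2])` of the layers `ℚ_n = ℚ(ζ_{2^{n+2}})⁺` of the cyclotomic `ℤ₂`-tower (what a `2`-descent computes)

HONEST FRAMING (cell `bsd-f1-sign2`, WIDTH-5 attached prover seat `bsd-line-att-p5` gen 44 on line `birth` of the lead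
`bsd-line-att-p2`; `--supports` stmt-BirchSwinnertonDyer-22298, closes nothing; BSD is NOT proved by any of this; the crux C2,
its verdict «blocked-on `Rank1Residual.GreenbergMuConjectureIrreducible`» and every registered stub are untouched). THEOREMS ONLY —
no `def`, no instance, no named fact, no `sorry`. PLACEMENT: COROLLARY-OF-TREE (pure bookkeeping over g39's model
`Sel_{2^∞}(E_{ℚ_n}/ℚ_n) ≃ W.selmerLayer κ n`, g43's Σ₁ form of stub T `seedMuZero_iff_exists_selmer_rankJump_two`, Silverman X.4.2 and
the `2`-division cubic: `Literature/…/SelmerDescentCurrencyProofs`).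

WHY. g43 made the route text «`μ_alg = 0` per curve, decidable by `2`-descent» a kernel theorem in the currency `#Sel_{2^∞}(E/ℚ_n)[2]`
(`(↥(W.selmerLayer κ n))[2]`), and its CENSUS ASK (§3 of `Cruxes/…/SELMER-RANK-JUMP-MU-DOOR-att-p5-g43.md`) asks a descent engine for
`rk₂ Sel₂(E/ℚ_n)` — the `2`-Selmer group `Sel^(2)(E/ℚ_n) ⊆ H¹(ℚ_n, E[2])` of a `2`-descent (tree `selmerGroup · 2`), which is NOT the
same group: `#Sel^(2)(E/F) = #E(F)[2] · #Sel_{2^∞}(E/F)[2]` (Literature §1). This file closes that seam: on the cell (no rational point of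
order `2`) the `2`-division cubic of `W` is irreducible over `ℚ`, so `E(ℚ_n)[2] = 0` at EVERY layer (`[ℚ_n : ℚ] = 2ⁿ` is prime to `3`;
Literature §2–§3), hence `#Sel^(2)(E_{ℚ_n}/ℚ_n) = #(W.selmerLayer κ n)[2]` and stub T at `(W, κ, γ, D)` reads, COMPLETE, in the numbers a
`2`-descent over the number fields `ℚ_j`, `ℚ_k` returns:

* §1 `natCard_torsionBy_selmerGroupPInfty_layer_two_eq` — g39's count `#Sel_{2^∞}(E_{ℚ_n}/ℚ_n)[2] = #(W.selmerLayer κ n)[2]` moved to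
  the canonical `ℚ`-algebra structure of `ℚ_n` (the one a file over `ℚ` elaborates; `baseChange_layer_eq`, `Subsingleton (Algebra ℚ ℚ_n)`).
* §2 ★ `natCard_selmerGroup_two_layer_eq` — `#Sel^(2)(E_{ℚ_n}/ℚ_n) = #(W.selmerLayer κ n)[2]`; and the Mordell–Weil + Ш reading
  `natCard_torsionBy_selmerLayer_two_eq_pow_rank_mul_sha` — `#(W.selmerLayer κ n)[2] = 2^{rank E(ℚ_n)} · #Ш(E/ℚ_n)[2]` (any `W/ℚ`).
* §3 ★★★ `seedMuZero_iff_exists_descent_rankJump_two` — **`(D.IsTorsion ∧ D.mu = 0)` ⟺ ∃ `j < k`,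
  `#Sel^(2)(E/ℚ_k) · #ker g_k · 2^{2^j} < #Sel^(2)(E/ℚ_j) · 2^{2^k}`**; the door alone with the `λ`-bound
  `2^{λ} ≤ #Sel^(2)(E/ℚ_k) · #ker g_k` (`seedMuZero_of_descent_rankJump_two`); the ONE-LAYER door `#Sel^(2)(E/ℚ_n) · #ker g_n < 2^{2ⁿ}`
  (`seedMuZero_of_descent_oneLayer_two`).
* §4 ★★ `seedMuZero_iff_exists_rank_sha_jump_two` — the same with `2^{r_n} · #Ш(E/ℚ_n)[2]` in place of `#Sel^(2)(E/ℚ_n)`: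
  `r_k + s_k + log₂ #ker g_k − r_j − s_j < 2^k − 2^j` (`r_n = rank E(ℚ_n)`, `s_n = dim_{𝔽₂} Ш(E/ℚ_n)[2]`).
* §5 the consumers re-keyed: ★★ `towerGapAtTwo_iff_forall_exists_descent_rankJump` — cell `bsd-2adic`'s certificate `X5.O1.TowerGapAtTwo W`
  (K10/T10; the extra binder of the RESTATEMENT C2′ `…SeedKernelEC.mainConjectureOfRankZeroBSDAtTwo_certified`) ⟺ for every cyclotomic
  datum ∃ `j < k` with the `2`-descent inequality; ★★★ `mazurMainConjecture_two_of_bsdp_of_descent_rankJump` — `MazurMainConjecture W 2` for a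
  seed from PRINT₄ {Kato 17.4 (1)(2) at `2`, period unit, modularity, GZK} + `r_an = 0` + `BSD₂(W)` + ONE `2`-descent inequality per
  cyclotomic presentation; `mainConjectureOfRankZeroBSDAtTwo_of_descent_rankJump` — C2 BY NAME from PRINT₄ + the class-wide descent
  statement (CONDITIONAL, closes nothing; g43's `…MuDoorCrux` re-keyed).

What this does NOT do: run any descent (kit-sized; `kit_allowed` is false on this seat), bound `#ker g_n` explicitly (that is the TOWER
road's currency: `KatoHalfPinch.towerGapAtTwo_of_layerSelmer_cert`, `C_2 = #Ẽ(𝔽₂)(2)² ∈ {4, 16}` at the prime above `2`, Lemma 3.3 at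
`ℓ ∣ N`), prove T for any curve, or touch the `μ`-conjecture. References: J. H. Silverman, GTM 106 (2009), III.§2, X.4.2 [SilvermanAEC2009];
R. Greenberg, LNM 1716 (1999), §1 Conj. 1.11, §2 pp. 62–63, §3 Lemmas 3.1–3.5 [GreenbergLNM1716]; L. Washington, GTM 83, §13.1, §13.3
[Washington1997].
-/

set_option linter.dupNamespace false
set_option autoImplicit false

noncomputable section

open scoped Classical AddSubgroup

universe u

namespace Summit.BirchSwinnertonDyer.BirchSwinnertonDyer.Theorems.AlignedTransportAtTwoSelmerLayerMuDoorDescent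

open WeierstrassCurve Literature.NumberTheory.EllipticCurves Literature.NumberTheory.EllipticCurves.Greenberg1999
  Summit.BirchSwinnertonDyer.BirchSwinnertonDyer.Theorems.AlignedTransportAtTwoSelmerLayerModel
  Summit.BirchSwinnertonDyer.BirchSwinnertonDyer.Theorems.AlignedTransportAtTwoSelmerLayerMuDoor
  Summit.BirchSwinnertonDyer.BirchSwinnertonDyer.Theorems.AlignedTransportAtTwoSelmerLayerMuDoorComplete
  Summit.BirchSwinnertonDyer.BirchSwinnertonDyer.Theorems.AlignedTransportAtTwoSelmerLayerMuDoorOneLayer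
  Summit.BirchSwinnertonDyer.BirchSwinnertonDyer.Theorems.AlignedTransportAtTwoSelmerLayerMuDoorTowerGap
  Summit.BirchSwinnertonDyer.BirchSwinnertonDyer.Theorems.AlignedTransportAtTwoSelmerLayerMuDoorCrux

variable (W : WeierstrassCurve ℚ) [W.IsElliptic] [W.IsGloballyMinimal]

/-! ## §1 The layer model in the `ℚ`-algebra structure of record

g39's model `natCard_torsionBy_selmerLayer_eq` was elaborated for a general base field `K`, so its base change `W.baseChange (κ.layer n)`
carries the intermediate-field `ℚ`-algebra structure of `ℚ_n ⊆ ℚ̄`; a file working over `ℚ` elaborates `W.baseChange (κ.layer n)` with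
Mathlib's canonical `ℚ`-algebra structure of a characteristic-zero field. The two structures are equal (`Subsingleton (Algebra ℚ ℚ_n)`),
hence so are the two base changes; this section moves g39's count to the structure of record. -/

omit [W.IsElliptic] [W.IsGloballyMinimal] in
/-- The base change of `W` to a layer `ℚ_n` along the intermediate-field `ℚ`-algebra structure of `ℚ_n ⊆ ℚ̄` IS its base change
along the canonical `ℚ`-algebra structure (all `ℚ`-algebra structures on a ring coincide). [cite: Washington1997, §13.1] -/
theorem baseChange_layer_eq (κ : ZpExtension ℚ 2) (n : ℕ) :
    @WeierstrassCurve.baseChange ℚ _ W (κ.layer n) _ (κ.layer n).algebra = W.baseChange (κ.layer n) := by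
  congr 1

omit [W.IsElliptic] [W.IsGloballyMinimal] in
/-- **`#Sel_{2^∞}(E_{ℚ_n}/ℚ_n)[2] = #(W.selmerLayer κ n)[2]`** — g39's `natCard_torsionBy_selmerLayer_eq` (the layer Selmer group IS the
Selmer group of the layer) read with the canonical `ℚ`-algebra structure on `ℚ_n` and the literal `2`.
[cite: GreenbergLNM1716, §2 and §3] [cite: Washington1997, §13.1] -/
theorem natCard_torsionBy_selmerGroupPInfty_layer_two_eq (κ : ZpExtension ℚ 2) (n : ℕ) :
    Nat.card ((↥((W.baseChange (κ.layer n)).selmerGroupPInfty 2))[(2 : ℤ)]) = Nat.card ((↥(W.selmerLayer κ n))[(2 : ℤ)]) := by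
  have h := natCard_torsionBy_selmerLayer_eq W κ n 2
  rw [baseChange_layer_eq W κ n] at h
  exact_mod_cast h

/-! ## §2 `#Sel^(2)(E_{ℚ_n}/ℚ_n) = #(W.selmerLayer κ n)[2]`, and the Mordell–Weil + Ш reading -/

omit [W.IsElliptic] [W.IsGloballyMinimal] in
/-- `[ℚ_n : ℚ] = 2ⁿ` is prime to `3` (`ZpExtension.finrank_layer_holds`). [cite: Washington1997, §13.1] -/
theorem not_three_dvd_finrank_layer (κ : ZpExtension ℚ 2) (n : ℕ) : ¬ 3 ∣ Module.finrank ℚ (κ.layer n) := by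
  rw [κ.finrank_layer_holds n]
  intro h
  have h32 : (3 : ℕ) ∣ 2 := Nat.Prime.dvd_of_dvd_pow Nat.prime_three h
  omega

omit [W.IsGloballyMinimal] in
/-- **`#(W.selmerLayer κ n)[2] ≤ #Sel^(2)(E_{ℚ_n}/ℚ_n)`** for EVERY elliptic `W/ℚ` (no torsion hypothesis): the `2`-descent over the
layer number field over-counts the `Γ_ℚ`-internal layer Selmer group's `2`-torsion by exactly `#E(ℚ_n)[2]` (Literature §1 + g39's model).
[cite: SilvermanAEC2009, Thm. X.4.2] [cite: GreenbergLNM1716, §2–§3] -/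
theorem natCard_torsionBy_selmerLayer_two_le_natCard_selmerGroup (κ : ZpExtension ℚ 2) (n : ℕ) :
    Nat.card ((↥(W.selmerLayer κ n))[(2 : ℤ)]) ≤ Nat.card ((W.baseChange (κ.layer n)).selmerGroup 2) := by
  have h := (W.baseChange (κ.layer n)).natCard_torsionBy_selmerGroupPInfty_le_natCard_selmerGroup 2
  rw [← natCard_torsionBy_selmerGroupPInfty_layer_two_eq W κ n]
  exact_mod_cast h

omit [W.IsGloballyMinimal] in
/-- ★ **`#Sel^(2)(E_{ℚ_n}/ℚ_n) = #(W.selmerLayer κ n)[2]`** at every layer `ℚ_n` of a `ℤ₂`-extension `κ` of `ℚ`, for `W/ℚ` elliptic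
WITHOUT a rational `2`-torsion abscissa: the `2`-Selmer group of a `2`-descent over the number field `ℚ_n` (tree `selmerGroup · 2`,
Silverman X.4.2) has exactly as many elements as the `2`-torsion of the `Γ_ℚ`-internal layer Selmer group `W.selmerLayer κ n`
(`≃ Sel_{2^∞}(E_{ℚ_n}/ℚ_n)`, g39), because `E(ℚ_n)[2] = 0` — the `2`-division cubic of `W` has no rational root, hence none in the
extension `ℚ_n` of degree `2ⁿ` prime to `3` (Literature `natCard_selmerGroup_two_baseChange_eq_of_forall_not_hasRationalTwoTorsionX`).
[cite: SilvermanAEC2009, Thm. X.4.2 and §III.2] [cite: GreenbergLNM1716, §2–§3] [cite: Washington1997, §13.1] -/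
theorem natCard_selmerGroup_two_layer_eq (ht : ∀ x : ℚ, ¬ HasRationalTwoTorsionX W x) (κ : ZpExtension ℚ 2) (n : ℕ) :
    Nat.card ((W.baseChange (κ.layer n)).selmerGroup 2) = Nat.card ((↥(W.selmerLayer κ n))[(2 : ℤ)]) := by
  rw [← natCard_torsionBy_selmerGroupPInfty_layer_two_eq W κ n]
  exact W.natCard_selmerGroup_two_baseChange_eq_of_forall_not_hasRationalTwoTorsionX (L := κ.layer n) ht
    (not_three_dvd_finrank_layer κ n)

omit [W.IsGloballyMinimal] in
/-- **`#(W.selmerLayer κ n)[2] = 2^{rank E(ℚ_n)} · #Ш(E_{ℚ_n}/ℚ_n)[2]`** for EVERY `W/ℚ` elliptic, every `ℤ₂`-extension `κ`, every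
layer: Greenberg §2's fundamental sequence over the number field `ℚ_n` counted on `2`-torsion (tree
`natCard_torsionBy_selmerGroupPInfty_eq`), transported through g39's model. [cite: GreenbergLNM1716, §2 pp. 62–63 and §3]
[cite: SilvermanAEC2009, Thm. X.4.2] -/
theorem natCard_torsionBy_selmerLayer_two_eq_pow_rank_mul_sha (κ : ZpExtension ℚ 2) (n : ℕ) :
    Nat.card ((↥(W.selmerLayer κ n))[(2 : ℤ)]) =
      2 ^ (W.baseChange (κ.layer n)).mordellWeilRank * Nat.card ((↥(W.baseChange (κ.layer n)).sha)[(2 : ℤ)]) := by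
  have h := (W.baseChange (κ.layer n)).natCard_torsionBy_selmerGroupPInfty_eq 2
  rw [← natCard_torsionBy_selmerGroupPInfty_layer_two_eq W κ n]
  exact_mod_cast h

omit [W.IsGloballyMinimal] in
/-- **`#Sel^(2)(E_{ℚ_n}/ℚ_n) = 2^{rank E(ℚ_n)} · #Ш(E_{ℚ_n}/ℚ_n)[2]`** on the cell (no rational `2`-torsion abscissa): Silverman X.4.2
over `ℚ_n` with `E(ℚ_n)[2] = 0`. [cite: SilvermanAEC2009, Thm. X.4.2 and §III.2] -/
theorem natCard_selmerGroup_two_layer_eq_pow_rank_mul_sha (ht : ∀ x : ℚ, ¬ HasRationalTwoTorsionX W x)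
    (κ : ZpExtension ℚ 2) (n : ℕ) :
    Nat.card ((W.baseChange (κ.layer n)).selmerGroup 2) =
      2 ^ (W.baseChange (κ.layer n)).mordellWeilRank * Nat.card ((↥(W.baseChange (κ.layer n)).sha)[(2 : ℤ)]) := by
  rw [natCard_selmerGroup_two_layer_eq W ht κ n, natCard_torsionBy_selmerLayer_two_eq_pow_rank_mul_sha W κ n]

/-! ## §3 Stub T per curve in descent currency: the two-layer door, complete, and the one-layer door -/

/-- ★★★ **STUB T PER CURVE ⟺ AN INEQUALITY BETWEEN TWO `2`-DESCENTS.** For every `W/ℚ` (globally minimal, elliptic) good ordinary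
at `2` WITHOUT a rational point of order `2`, the cyclotomic `ℤ₂`-extension `κ` with topological generator `γ`, and ANY dual datum
`D`: **`(D.IsTorsion ∧ D.mu = 0)` ⟺ there are layers `j < k` with
`#Sel^(2)(E/ℚ_k) · #ker g_k · 2^{2^j} < #Sel^(2)(E/ℚ_j) · 2^{2^k}`**, where `Sel^(2)(E/ℚ_n) = selmerGroup (W.baseChange ℚ_n) 2` is
the `2`-Selmer group of a `2`-descent over the number field `ℚ_n = κ.layer n` (degree `2ⁿ`, `ℚ ⊂ ℚ(√2) ⊂ ℚ(ζ₁₆)⁺ ⊂ ⋯`) and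
`ker g_n = W.KerG κ n` is Greenberg's finite local defect. g43's Σ₁ form `seedMuZero_iff_exists_selmer_rankJump_two` rewritten
with §2. Nothing here proves T for any curve. [cite: GreenbergLNM1716, §1 Conj. 1.11; §3 Lemmas 3.1–3.5] [cite: SilvermanAEC2009, Thm. X.4.2]
[cite: Washington1997, §13.3 Prop. 13.23] -/
theorem seedMuZero_iff_exists_descent_rankJump_two (hord : IsOrdinaryAt W 2) (ht : ∀ x : ℚ, ¬ HasRationalTwoTorsionX W x)
    (κ : ZpExtension ℚ 2) (hκ : κ.IsCyclotomic) {γ : Field.absoluteGaloisGroup ℚ} (hγ : κ.IsTopGenerator γ)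
    (D : W.SelmerDualData κ γ) :
    (D.IsTorsion ∧ D.mu = 0) ↔ ∃ j k : ℕ, j < k ∧
      Nat.card ((W.baseChange (κ.layer k)).selmerGroup 2) * Nat.card (W.KerG κ k) * 2 ^ (2 ^ j) <
        Nat.card ((W.baseChange (κ.layer j)).selmerGroup 2) * 2 ^ (2 ^ k) := by
  simp only [natCard_selmerGroup_two_layer_eq W ht κ]
  exact seedMuZero_iff_exists_selmer_rankJump_two W hord ht κ hκ hγ D

/-- ★★★ **The door alone, with the `λ`-bound, in descent currency**: ONE inequality
`#Sel^(2)(E/ℚ_k) · #ker g_k · 2^{2^j} < #Sel^(2)(E/ℚ_j) · 2^{2^k}` at a pair `j < k` gives `X(W/ℚ_∞)` torsion, `μ₂(X) = 0`, `X` finitely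
generated over `ℤ₂` and `2^{λ(X)} ≤ #Sel^(2)(E/ℚ_k) · #ker g_k`. [cite: GreenbergLNM1716, §1 Conj. 1.11; §3 Lemmas 3.1–3.4]
[cite: SilvermanAEC2009, Thm. X.4.2] [cite: Washington1997, §13.3 Prop. 13.23] -/
theorem seedMuZero_of_descent_rankJump_two (hord : IsOrdinaryAt W 2) (ht : ∀ x : ℚ, ¬ HasRationalTwoTorsionX W x)
    (κ : ZpExtension ℚ 2) (hκ : κ.IsCyclotomic) {γ : Field.absoluteGaloisGroup ℚ} (hγ : κ.IsTopGenerator γ)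
    (D : W.SelmerDualData κ γ) {j k : ℕ} (hjk : j < k)
    (hlt : Nat.card ((W.baseChange (κ.layer k)).selmerGroup 2) * Nat.card (W.KerG κ k) * 2 ^ (2 ^ j) <
      Nat.card ((W.baseChange (κ.layer j)).selmerGroup 2) * 2 ^ (2 ^ k)) :
    D.IsTorsion ∧ D.mu = 0 ∧ Module.Finite ℤ_[2] (RestrictScalars ℤ_[2] (IwasawaAlgebra 2) D.X) ∧
      2 ^ D.lambda ≤ Nat.card ((W.baseChange (κ.layer k)).selmerGroup 2) * Nat.card (W.KerG κ k) := by
  rw [natCard_selmerGroup_two_layer_eq W ht κ k] at hlt ⊢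
  rw [natCard_selmerGroup_two_layer_eq W ht κ j] at hlt
  exact seedMuZero_of_selmer_rankJump_two W hord ht κ hκ hγ D hjk hlt

/-- ★★ **The ONE-LAYER door in descent currency**: `#Sel^(2)(E/ℚ_n) · #ker g_n < 2^{2ⁿ}` at ONE layer `n` gives `X` torsion, `μ₂ = 0`,
and `2^{λ} ≤ #Sel^(2)(E/ℚ_n) · #ker g_n` (g43's `seedMuZero_of_selmer_oneLayer_two`; since `#ker g_n ≥ 4` at `2`, first possible at
`n = 2`: one `2`-descent over `ℚ(ζ₁₆)⁺` with `rk₂ Sel^(2) + log₂ #ker g_2 ≤ 3`). [cite: GreenbergLNM1716, §1 pp. 60–62; §3 Lemmas 3.1–3.4]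
[cite: SilvermanAEC2009, Thm. X.4.2] -/
theorem seedMuZero_of_descent_oneLayer_two (hord : IsOrdinaryAt W 2) (ht : ∀ x : ℚ, ¬ HasRationalTwoTorsionX W x)
    (κ : ZpExtension ℚ 2) (hκ : κ.IsCyclotomic) {γ : Field.absoluteGaloisGroup ℚ} (hγ : κ.IsTopGenerator γ)
    (D : W.SelmerDualData κ γ) (n : ℕ)
    (hlt : Nat.card ((W.baseChange (κ.layer n)).selmerGroup 2) * Nat.card (W.KerG κ n) < 2 ^ (2 ^ n)) :
    D.IsTorsion ∧ D.mu = 0 ∧ Module.Finite ℤ_[2] (RestrictScalars ℤ_[2] (IwasawaAlgebra 2) D.X) ∧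
      2 ^ D.lambda ≤ Nat.card ((W.baseChange (κ.layer n)).selmerGroup 2) * Nat.card (W.KerG κ n) := by
  rw [natCard_selmerGroup_two_layer_eq W ht κ n] at hlt ⊢
  exact seedMuZero_of_selmer_oneLayer_two W hord ht κ hκ hγ D n hlt

/-! ## §4 The Mordell–Weil + Ш reading -/

/-- ★★ **STUB T PER CURVE ⟺ a rank + Ш[2] inequality between two layers.** On the cell (good ordinary at `2`, no rational point of
order `2`; `κ` cyclotomic, `γ` a topological generator, ANY dual datum `D`): `(D.IsTorsion ∧ D.mu = 0)` ⟺ ∃ `j < k`,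
`2^{r_k} · #Ш(E/ℚ_k)[2] · #ker g_k · 2^{2^j} < 2^{r_j} · #Ш(E/ℚ_j)[2] · 2^{2^k}` with `r_n = rank E(ℚ_n)` — in logarithms
`r_k + s_k + log₂ #ker g_k − r_j − s_j < 2^k − 2^j`, `s_n = dim_{𝔽₂} Ш(E/ℚ_n)[2]`. [cite: GreenbergLNM1716, §1 Conj. 1.11; §2 pp. 62–63;
§3 Lemmas 3.1–3.5] [cite: SilvermanAEC2009, Thm. X.4.2] [cite: Washington1997, §13.3 Prop. 13.23] -/
theorem seedMuZero_iff_exists_rank_sha_jump_two (hord : IsOrdinaryAt W 2) (ht : ∀ x : ℚ, ¬ HasRationalTwoTorsionX W x)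
    (κ : ZpExtension ℚ 2) (hκ : κ.IsCyclotomic) {γ : Field.absoluteGaloisGroup ℚ} (hγ : κ.IsTopGenerator γ)
    (D : W.SelmerDualData κ γ) :
    (D.IsTorsion ∧ D.mu = 0) ↔ ∃ j k : ℕ, j < k ∧
      2 ^ (W.baseChange (κ.layer k)).mordellWeilRank * Nat.card ((↥(W.baseChange (κ.layer k)).sha)[(2 : ℤ)]) *
          Nat.card (W.KerG κ k) * 2 ^ (2 ^ j) <
        2 ^ (W.baseChange (κ.layer j)).mordellWeilRank * Nat.card ((↥(W.baseChange (κ.layer j)).sha)[(2 : ℤ)]) *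
          2 ^ (2 ^ k) := by
  simp only [← natCard_torsionBy_selmerLayer_two_eq_pow_rank_mul_sha W κ]
  exact seedMuZero_iff_exists_selmer_rankJump_two W hord ht κ hκ hγ D

/-! ## §5 The consumers re-keyed: cell `bsd-2adic`'s tower gap, `MazurMainConjecture W 2` per seed, and C2 by name -/

section Consumers

open scoped MatrixGroups ModularForm

open CongruenceSubgroup Literature.NumberTheory.EllipticCurves.ModularForms Literature.NumberTheory.EllipticCurves.Rank1Residual
  Literature.NumberTheory.EllipticCurves.Rank1Residual.Typed Summit.BirchSwinnertonDyer.Rank1Residual.X5.O1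
  Summit.BirchSwinnertonDyer.BirchSwinnertonDyer.Theorems.Rank1ResidualX1Defs
  Summit.BirchSwinnertonDyer.BirchSwinnertonDyer.Theses.AlignedTransportAtTwo

/-- ★★ **Cell `bsd-2adic`'s tower-gap certificate ⟺ the `2`-descent Σ₁ statement.** For `W/ℚ` globally minimal, good ordinary at `2`,
without a rational point of order `2`: `X5.O1.TowerGapAtTwo W` (the X-level certificate K10/T10, the extra binder of the restatement C2′)
holds iff for every cyclotomic `κ` with a topological generator `γ` that is a cyclotomic variable there are layers `j < k` with
`#Sel^(2)(E/ℚ_k) · #ker g_k · 2^{2^j} < #Sel^(2)(E/ℚ_j) · 2^{2^k}` — g43's bridge `towerGapAtTwo_iff_forall_exists_selmer_rankJump` in the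
numbers a `2`-descent over `ℚ_j`, `ℚ_k` returns. [cite: GreenbergLNM1716, §1 Conj. 1.11; §3 Lemmas 3.1–3.5] [cite: SilvermanAEC2009, Thm. X.4.2]
[cite: Washington1997, §13.3 Prop. 13.23] -/
theorem towerGapAtTwo_iff_forall_exists_descent_rankJump (hord : IsOrdinaryAt W 2)
    (ht : ∀ x : ℚ, ¬ HasRationalTwoTorsionX W x) :
    TowerGapAtTwo W ↔
      ∀ (κ : ZpExtension ℚ 2) (γ : Field.absoluteGaloisGroup ℚ), κ.IsCyclotomic → κ.IsTopGenerator γ →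
        IsCyclotomicVariable 2 γ →
        ∃ j k : ℕ, j < k ∧
          Nat.card ((W.baseChange (κ.layer k)).selmerGroup 2) * Nat.card (W.KerG κ k) * 2 ^ (2 ^ j) <
            Nat.card ((W.baseChange (κ.layer j)).selmerGroup 2) * 2 ^ (2 ^ k) := by
  simp only [natCard_selmerGroup_two_layer_eq W ht]
  exact towerGapAtTwo_iff_forall_exists_selmer_rankJump W hord ht

/-- ★★★ **MAZUR'S `2`-ADIC MAIN CONJECTURE FOR A SEED FROM PRINT₄ + ONE INEQUALITY BETWEEN TWO `2`-DESCENTS.** For `W/ℚ` globally minimal,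
good ordinary at `2`, without rational `2`-torsion, with `r_an(W) = 0` and `BSD₂(W)`: if for the cyclotomic `ℤ₂`-extension `κ` (each
presentation) there is ONE pair of layers `j < k` with `#Sel^(2)(E/ℚ_k) · #ker g_k · 2^{2^j} < #Sel^(2)(E/ℚ_j) · 2^{2^k}`
(`Sel^(2)(E/ℚ_n) = selmerGroup (W.baseChange (κ.layer n)) 2`, the `2`-Selmer group of a `2`-descent over the number field `ℚ_n`), then
`MazurMainConjecture W 2` — modulo PRINT₄ {Kato 17.4 (1)(2) at `2`, period unit, modularity, GZK}, displayed. g43's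
`mazurMainConjecture_two_of_bsdp_of_selmer_rankJump` re-keyed by §2. CONDITIONAL on PRINT₄; BSD is not proved by this.
[cite: GreenbergLNM1716, §1 Conj. 1.11 and Thm. 4.1] [cite: Kato2004Asterisque, Thm. 17.4 (1)(2) (p. 273)] [cite: SilvermanAEC2009, Thm. X.4.2] -/
theorem mazurMainConjecture_two_of_bsdp_of_descent_rankJump
    (h17 : ∀ [NeZero (W.conductorNorm ℤ)] (f : CuspForm (Gamma0 (W.conductorNorm ℤ)) 2),
      kato_divisibility_allPrimes W 2 (f := f))
    (hper : realPeriodRat_eq_unit_mul_plusPeriod_two) (hmod : nonempty_modularParametrizationData)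
    (hGZK : rank_eq_analyticRank_of_analyticRank_le_one) (hord : IsOrdinaryAt W 2)
    (ht : ∀ x : ℚ, ¬ HasRationalTwoTorsionX W x) (hr : W.analyticRank = 0) (hbsd : BSDp W 2)
    (hjump : ∀ κ : ZpExtension ℚ 2, κ.IsCyclotomic →
      ∃ j k : ℕ, j < k ∧
        Nat.card ((W.baseChange (κ.layer k)).selmerGroup 2) * Nat.card (W.KerG κ k) * 2 ^ (2 ^ j) <
          Nat.card ((W.baseChange (κ.layer j)).selmerGroup 2) * 2 ^ (2 ^ k)) :
    MazurMainConjecture W 2 := by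
  refine mazurMainConjecture_two_of_bsdp_of_selmer_rankJump W h17 hper hmod hGZK hord ht hr hbsd fun κ hκ ↦ ?_
  simpa only [natCard_selmerGroup_two_layer_eq W ht κ] using hjump κ hκ

/-- ★★ **The crux C2 BY NAME from PRINT₄ + the class-wide `2`-DESCENT statement**: if every seed-cell curve (non-CM, good ordinary at `2`,
no rational `2`-torsion, `Δ ∉ ℚ²`, `r_an = 0`, `BSD₂`) satisfies, for each presentation of its cyclotomic `ℤ₂`-tower, ONE inequality
`#Sel^(2)(E/ℚ_k) · #ker g_k · 2^{2^j} < #Sel^(2)(E/ℚ_j) · 2^{2^k}` between the orders of two `2`-Selmer groups of `2`-descents over the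
layer number fields, then `MainConjectureOfRankZeroBSDAtTwo` (modulo PRINT₄). The descent statement replaces the OPEN stub T; it is
Σ₁ per curve and COMPLETE per curve (§3), but CLASS-WIDE it is exactly as open as Greenberg's Conj. 1.11 on the cell. CONDITIONAL;
closes nothing by itself. [cite: GreenbergLNM1716, §1 Conj. 1.11] [cite: Kato2004Asterisque, Thm. 17.4 (1)(2) (p. 273)]
[cite: SilvermanAEC2009, Thm. X.4.2] -/
theorem mainConjectureOfRankZeroBSDAtTwo_of_descent_rankJump
    (h17 : ∀ (V : WeierstrassCurve ℚ) [V.IsElliptic] [V.IsGloballyMinimal] [NeZero (V.conductorNorm ℤ)]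
      (f : CuspForm (Gamma0 (V.conductorNorm ℤ)) 2), kato_divisibility_allPrimes V 2 (f := f))
    (hper : realPeriodRat_eq_unit_mul_plusPeriod_two) (hmod : nonempty_modularParametrizationData)
    (hGZK : rank_eq_analyticRank_of_analyticRank_le_one)
    (hJ : ∀ (V : WeierstrassCurve ℚ) [V.IsElliptic] [V.IsGloballyMinimal], ¬ V.HasCM → IsOrdinaryAt V 2 →
      (∀ x : ℚ, ¬ HasRationalTwoTorsionX V x) → ¬ IsSquare V.Δ → V.analyticRank = 0 → BSDp V 2 →
      ∀ κ : ZpExtension ℚ 2, κ.IsCyclotomic →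
        ∃ j k : ℕ, j < k ∧
          Nat.card ((V.baseChange (κ.layer k)).selmerGroup 2) * Nat.card (V.KerG κ k) * 2 ^ (2 ^ j) <
            Nat.card ((V.baseChange (κ.layer j)).selmerGroup 2) * 2 ^ (2 ^ k)) :
    MainConjectureOfRankZeroBSDAtTwo := by
  intro V _ _ hcm hord ht hsq hr _ hbsd
  exact mazurMainConjecture_two_of_bsdp_of_descent_rankJump V (fun f ↦ h17 V f) hper hmod hGZK hord ht hr hbsd
    (hJ V hcm hord ht hsq hr hbsd)

end Consumers

end Summit.BirchSwinnertonDyer.BirchSwinnertonDyer.Theorems.AlignedTransportAtTwoSelmerLayerMuDoorDescent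

end
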